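import Summits.BirchSwinnertonDyer.BirchSwinnertonDyer.Theses.ShaPrimaryTransfer
import Literature.NumberTheory.EllipticCurves.KubertTateSevenVeluIsogeny
import Literature.NumberTheory.EllipticCurves.KubertTateM85ShaSeven
import Literature.NumberTheory.EllipticCurves.KubertTateM81ShaSeven
import Literature.NumberTheory.EllipticCurves.KubertTateM115ShaSeven
import Literature.NumberTheory.EllipticCurves.SelmerCorankIsogenyProofs
import Literature.NumberTheory.EllipticCurves.IsogenyMordellWeilRankProofs
import Literature.NumberTheory.EllipticCurves.SelmerCorankHolds
import HarnessLib

/-!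
# The door at `7` on the `μ₇`-side: `t₇(E'_{m,n}) = t₇(E_{m,n})`, so `t₇(E') = 0` on the `7`-isogenous curves

Helper for item **stmt-BirchSwinnertonDyer-22356** (`FiniteShaComponentTransfer`, «T», route
`ShaPrimaryTransfer`); it closes nothing by itself — `T` is conjecture-grade at analytic rank `≥ 2` and
**BSD is NOT proved by this file**. Companion of `…DoorAtSeven` (which it does not import: no Theses cone):
the Kubert–Tate `7`-torsion curve `E_{m,n} = kubertTateSeven m n = [n² + mn − m², m²n(n−m), m²n³(n−m), 0, 0]`
carries the rational `7`-isogeny `φ : E_{m,n} → E'_{m,n} = kubertTateSeven' m n` with kernel `⟨(0,0)⟩ ≅ ℤ/7`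
(tree `KubertTateSevenVelu.sevenIsogeny`, Vélu). Since `t_p` and the Mordell–Weil rank are ISOGENY INVARIANTS
(tree `IsIsogenous.shaCorank_eq`, `IsIsogenous.mordellWeilRank_eq`), every door opened on `E_{m,n}` is open
on the `μ₇`-kernel curve `E'_{m,n}` too:

* §0 CLASS-WIDE: `isIsogenous_kubertTateSeven'`, `shaCorank_kubertTateSeven'_eq` (`t_p(E') = t_p(E)`),
  `mordellWeilRank_kubertTateSeven'_eq`, and `T` by name on the dual family
  (`transfer_at_seven_kubertTateSeven'`: `T ∧ t₇(E_{m,n}) = 0 ⟹ ∀ q, t_q(E'_{m,n}) = 0`);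
* §1–§3 the three descent instances of `KubertTateM85ShaSeven` / `KubertTateM81ShaSeven` /
  `KubertTateM115ShaSeven` read on the isogenous curves
  `E'_{−8/5} = [−79, 4160, 104000, −420256200, −6319427772840]` (rank `2`),
  `E'_{−8} = [−71, 576, 576, 9014040, −8496701640]` (rank `1`),
  `E'_{−11/5} = [−151, 9680, 242000, −1219587600, −60137771213520]` (rank `2`):
  `t₇ = 0` UNCONDITIONALLY, the rank, `s₇ = rank`, `T ⟹ ∀ q, t_q = 0`, and the route's `O` (X1) instance.

## References

* [SilvermanAEC2009] J. H. Silverman, *AEC*, 2nd ed., Thm. X.4.2, III.4.12, III.6.1.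
* [Velu1971] J. Vélu, *Isogénies entre courbes elliptiques*, C. R. Acad. Sci. Paris 273 (1971) 238–241.
* [MilneADT2006] J. S. Milne, *Arithmetic Duality Theorems*, 2nd ed., Ch. I Lemma 7.1(b), p. 96.
* [Fisher2001FiveSevenDescent] T. Fisher, JEMS 3 (2001), §§1–2.
-/

noncomputable section

set_option linter.dupNamespace false

open WeierstrassCurve
open Literature.NumberTheory.EllipticCurves Literature.NumberTheory.EllipticCurves.KubertTateSevenVelu
open Summit.BirchSwinnertonDyer.BirchSwinnertonDyer.Theses.ShaPrimaryTransfer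

namespace Summit.BirchSwinnertonDyer.BirchSwinnertonDyer.Theorems.ShaPrimaryTransferDoorAtSevenDual

/-! ## §0 Class-wide: the `7`-isogenous curve `E'_{m,n}` has the same `t_p` and the same rank -/

/-- **`E_{m,n}` and `E'_{m,n}` are `ℚ`-isogenous** (Vélu's `7`-isogeny with kernel `⟨(0,0)⟩`, tree
`KubertTateSevenVelu.sevenIsogeny`). [cite: Velu1971, formulae] [cite: SilvermanAEC2009, III.4.12] -/
theorem isIsogenous_kubertTateSeven' (m n : ℤ) [(kubertTateSeven (m : ℚ) (n : ℚ)).IsElliptic] :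
    IsIsogenous (kubertTateSeven (m : ℚ) (n : ℚ)) (kubertTateSeven' (m : ℚ) (n : ℚ)) :=
  ⟨KubertTateSevenVelu.sevenIsogeny (m : ℚ) (n : ℚ)⟩

/-- **`t_p(E'_{m,n}) = t_p(E_{m,n})` for every prime `p`** (`t_p = corank_{ℤ_p} Ш[p^∞]` is an isogeny
invariant, tree `IsIsogenous.shaCorank_eq`). [cite: MilneADT2006, Ch. I Lemma 7.1(b) (proof), p. 96] -/
theorem shaCorank_kubertTateSeven'_eq (m n : ℤ) [(kubertTateSeven (m : ℚ) (n : ℚ)).IsElliptic]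
    (p : ℕ) [Fact p.Prime] :
    (kubertTateSeven' (m : ℚ) (n : ℚ)).shaCorank p = (kubertTateSeven (m : ℚ) (n : ℚ)).shaCorank p :=
  ((isIsogenous_kubertTateSeven' m n).shaCorank_eq p).symm

/-- **`rank E'_{m,n}(ℚ) = rank E_{m,n}(ℚ)`** (the Mordell–Weil rank is an isogeny invariant, tree
`IsIsogenous.mordellWeilRank_eq`). [cite: SilvermanAEC2009, III.6.1 and Thm. X.4.2] -/
theorem mordellWeilRank_kubertTateSeven'_eq (m n : ℤ) [(kubertTateSeven (m : ℚ) (n : ℚ)).IsElliptic] :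
    (kubertTateSeven' (m : ℚ) (n : ℚ)).mordellWeilRank = (kubertTateSeven (m : ℚ) (n : ℚ)).mordellWeilRank :=
  ((isIsogenous_kubertTateSeven' m n).mordellWeilRank_eq).symm

/-- `t₇(E'_{m,n}) = 0 ↔ t₇(E_{m,n}) = 0` — the door at `7` is open on `E'` iff it is open on `E`.
[cite: MilneADT2006, Ch. I Lemma 7.1(b) (proof), p. 96] -/
theorem shaCorank_seven_kubertTateSeven'_eq_zero_iff (m n : ℤ) [(kubertTateSeven (m : ℚ) (n : ℚ)).IsElliptic] :
    haveI : Fact (Nat.Prime 7) := ⟨by norm_num⟩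
    (kubertTateSeven' (m : ℚ) (n : ℚ)).shaCorank 7 = 0 ↔ (kubertTateSeven (m : ℚ) (n : ℚ)).shaCorank 7 = 0 := by
  rw [shaCorank_kubertTateSeven'_eq]

/-- **`T` BY NAME on the dual family**: granting `FiniteShaComponentTransfer`, an open door `t₇(E_{m,n}) = 0`
on `E_{m,n}` gives `t_q(E'_{m,n}) = 0` for EVERY prime `q` on the isogenous curve.
[cite: SilvermanAEC2009, Thm. X.4.2(a)] -/
theorem transfer_at_seven_kubertTateSeven' (hT : FiniteShaComponentTransfer) (m n : ℤ)
    [(kubertTateSeven (m : ℚ) (n : ℚ)).IsElliptic]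
    (h7 : haveI : Fact (Nat.Prime 7) := ⟨by norm_num⟩; (kubertTateSeven (m : ℚ) (n : ℚ)).shaCorank 7 = 0)
    (q : ℕ) [Fact q.Prime] :
    (kubertTateSeven' (m : ℚ) (n : ℚ)).shaCorank q = 0 := by
  haveI : Fact (Nat.Prime 7) := ⟨by norm_num⟩
  exact hT _ 7 q ((shaCorank_seven_kubertTateSeven'_eq_zero_iff m n).2 h7)

/-- The route's `O = OneFiniteShaComponent` on the dual family: an open door at `7` on `E_{m,n}` is a witness
prime for `E'_{m,n}`. [cite: SilvermanAEC2009, Thm. X.4.2(a)] -/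
theorem oneFiniteShaComponent_kubertTateSeven' (m n : ℤ) [(kubertTateSeven (m : ℚ) (n : ℚ)).IsElliptic]
    (h7 : haveI : Fact (Nat.Prime 7) := ⟨by norm_num⟩; (kubertTateSeven (m : ℚ) (n : ℚ)).shaCorank 7 = 0) :
    ∃ (p : ℕ) (_ : Fact p.Prime), (kubertTateSeven' (m : ℚ) (n : ℚ)).shaCorank p = 0 :=
  ⟨7, ⟨by norm_num⟩, (shaCorank_seven_kubertTateSeven'_eq_zero_iff m n).2 h7⟩

/-! ## §1 `E'_{−8/5} = [−79, 4160, 104000, −420256200, −6319427772840]` (rank `2`) -/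

/-- The coefficients of the `7`-isogenous curve `E'_{−8/5}`. [cite: Velu1971, formulae] -/
theorem curve_eq_E₂' :
    kubertTateSeven' (((-8 : ℤ) : ℚ)) (((5 : ℤ) : ℚ)) = ⟨-79, 4160, 104000, -420256200, -6319427772840⟩ := by
  simp only [kubertTateSeven']
  norm_num

/-- **`t₇(E'_{−8/5}) = 0`, UNCONDITIONALLY** (complete `7`-descent on `E_{−8/5}`, tree
`KubertTateM85Descent.shaCorank_seven_eq_zero`, carried along the `7`-isogeny).
[cite: SilvermanAEC2009, Thm. X.4.2(a)] [cite: Fisher2001FiveSevenDescent, §2] -/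
theorem shaCorank_seven_E₂' :
    haveI := KubertTateM85Descent.isElliptic
    (kubertTateSeven' (((-8 : ℤ) : ℚ)) (((5 : ℤ) : ℚ))).shaCorank 7 = 0 :=
  haveI := KubertTateM85Descent.isElliptic
  (shaCorank_seven_kubertTateSeven'_eq_zero_iff (-8) 5).2 KubertTateM85Descent.shaCorank_seven_eq_zero

/-- **`rank E'_{−8/5}(ℚ) = 2`, unconditionally.** [cite: SilvermanAEC2009, III.6.1 and Thm. X.4.2] -/
theorem mordellWeilRank_E₂' :
    haveI := KubertTateM85Descent.isElliptic
    (kubertTateSeven' (((-8 : ℤ) : ℚ)) (((5 : ℤ) : ℚ))).mordellWeilRank = 2 :=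
  haveI := KubertTateM85Descent.isElliptic
  (mordellWeilRank_kubertTateSeven'_eq (-8) 5).trans KubertTateM85Descent.mordellWeilRank_eq

/-- **`s₇(E'_{−8/5}) = 2 = rank`** (`s_p = r + t_p`). [cite: SilvermanAEC2009, Thm. X.4.2(b)] -/
theorem selmerCorank_seven_E₂' :
    haveI := KubertTateM85Descent.isElliptic
    (kubertTateSeven' (((-8 : ℤ) : ℚ)) (((5 : ℤ) : ℚ))).selmerCorank 7 = 2 := by
  haveI := KubertTateM85Descent.isElliptic
  haveI : Fact (Nat.Prime 7) := ⟨by norm_num⟩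
  rw [(kubertTateSeven' (((-8 : ℤ) : ℚ)) (((5 : ℤ) : ℚ))).selmerCorank_eq_mordellWeilRank_add_holds 7,
    shaCorank_seven_E₂', mordellWeilRank_E₂']

/-- **`T` BY NAME at `p₀ = 7` on `E'_{−8/5}`**: granting `FiniteShaComponentTransfer`, `t_q(E'_{−8/5}) = 0` for
every prime `q`. [cite: SilvermanAEC2009, Thm. X.4.2(a)] -/
theorem transfer_at_seven_E₂' (hT : FiniteShaComponentTransfer) (q : ℕ) [Fact q.Prime] :
    haveI := KubertTateM85Descent.isElliptic
    (kubertTateSeven' (((-8 : ℤ) : ℚ)) (((5 : ℤ) : ℚ))).shaCorank q = 0 :=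
  haveI := KubertTateM85Descent.isElliptic
  transfer_at_seven_kubertTateSeven' hT (-8) 5 KubertTateM85Descent.shaCorank_seven_eq_zero q

/-- Under `T`: every `s_q(E'_{−8/5}) = 2 = rank`. [cite: SilvermanAEC2009, Thm. X.4.2(b)] -/
theorem selmerCorank_E₂'_of_transfer (hT : FiniteShaComponentTransfer) (q : ℕ) [Fact q.Prime] :
    haveI := KubertTateM85Descent.isElliptic
    (kubertTateSeven' (((-8 : ℤ) : ℚ)) (((5 : ℤ) : ℚ))).selmerCorank q = 2 := by
  haveI := KubertTateM85Descent.isElliptic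
  rw [(kubertTateSeven' (((-8 : ℤ) : ℚ)) (((5 : ℤ) : ℚ))).selmerCorank_eq_mordellWeilRank_add_holds q,
    transfer_at_seven_E₂' hT q, mordellWeilRank_E₂']

/-- **The route's `O` holds for `E'_{−8/5}`, witness `p₀ = 7`, unconditionally** (rank `2`).
[cite: SilvermanAEC2009, Thm. X.4.2(a)] -/
theorem oneFiniteShaComponent_E₂' :
    haveI := KubertTateM85Descent.isElliptic
    ∃ (p : ℕ) (_ : Fact p.Prime), (kubertTateSeven' (((-8 : ℤ) : ℚ)) (((5 : ℤ) : ℚ))).shaCorank p = 0 :=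
  haveI := KubertTateM85Descent.isElliptic
  oneFiniteShaComponent_kubertTateSeven' (-8) 5 KubertTateM85Descent.shaCorank_seven_eq_zero

/-! ## §2 `E'_{−8} = [−71, 576, 576, 9014040, −8496701640]` (rank `1`) -/

/-- The coefficients of the `7`-isogenous curve `E'_{−8}`. [cite: Velu1971, formulae] -/
theorem curve_eq_E₁' :
    kubertTateSeven' (((-8 : ℤ) : ℚ)) (((1 : ℤ) : ℚ)) = ⟨-71, 576, 576, 9014040, -8496701640⟩ := by
  simp only [kubertTateSeven']
  norm_num

/-- **`t₇(E'_{−8}) = 0`, UNCONDITIONALLY** (tree `KubertTateM81Descent.shaCorank_seven_eq_zero` carried along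
the `7`-isogeny). [cite: SilvermanAEC2009, Thm. X.4.2(a)] [cite: Fisher2001FiveSevenDescent, §2] -/
theorem shaCorank_seven_E₁' :
    haveI := KubertTateM81Descent.isElliptic
    (kubertTateSeven' (((-8 : ℤ) : ℚ)) (((1 : ℤ) : ℚ))).shaCorank 7 = 0 :=
  haveI := KubertTateM81Descent.isElliptic
  (shaCorank_seven_kubertTateSeven'_eq_zero_iff (-8) 1).2 KubertTateM81Descent.shaCorank_seven_eq_zero

/-- **`rank E'_{−8}(ℚ) = 1`, unconditionally.** [cite: SilvermanAEC2009, III.6.1 and Thm. X.4.2] -/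
theorem mordellWeilRank_E₁' :
    haveI := KubertTateM81Descent.isElliptic
    (kubertTateSeven' (((-8 : ℤ) : ℚ)) (((1 : ℤ) : ℚ))).mordellWeilRank = 1 :=
  haveI := KubertTateM81Descent.isElliptic
  (mordellWeilRank_kubertTateSeven'_eq (-8) 1).trans KubertTateM81Descent.mordellWeilRank_eq

/-- **`T` BY NAME at `p₀ = 7` on `E'_{−8}`.** [cite: SilvermanAEC2009, Thm. X.4.2(a)] -/
theorem transfer_at_seven_E₁' (hT : FiniteShaComponentTransfer) (q : ℕ) [Fact q.Prime] :
    haveI := KubertTateM81Descent.isElliptic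
    (kubertTateSeven' (((-8 : ℤ) : ℚ)) (((1 : ℤ) : ℚ))).shaCorank q = 0 :=
  haveI := KubertTateM81Descent.isElliptic
  transfer_at_seven_kubertTateSeven' hT (-8) 1 KubertTateM81Descent.shaCorank_seven_eq_zero q

/-- **The route's `O` holds for `E'_{−8}`, witness `p₀ = 7`, unconditionally** (rank `1`).
[cite: SilvermanAEC2009, Thm. X.4.2(a)] -/
theorem oneFiniteShaComponent_E₁' :
    haveI := KubertTateM81Descent.isElliptic
    ∃ (p : ℕ) (_ : Fact p.Prime), (kubertTateSeven' (((-8 : ℤ) : ℚ)) (((1 : ℤ) : ℚ))).shaCorank p = 0 :=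
  haveI := KubertTateM81Descent.isElliptic
  oneFiniteShaComponent_kubertTateSeven' (-8) 1 KubertTateM81Descent.shaCorank_seven_eq_zero

/-! ## §3 `E'_{−11/5} = [−151, 9680, 242000, −1219587600, −60137771213520]` (rank `2`) -/

/-- The coefficients of the `7`-isogenous curve `E'_{−11/5}`. [cite: Velu1971, formulae] -/
theorem curve_eq_E₃' :
    kubertTateSeven' (((-11 : ℤ) : ℚ)) (((5 : ℤ) : ℚ)) =
      ⟨-151, 9680, 242000, -1219587600, -60137771213520⟩ := by
  simp only [kubertTateSeven']
  norm_num

/-- **`t₇(E'_{−11/5}) = 0`, UNCONDITIONALLY** (tree `KubertTateM115Descent.shaCorank_seven_eq_zero` carried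
along the `7`-isogeny). [cite: SilvermanAEC2009, Thm. X.4.2(a)] [cite: Fisher2001FiveSevenDescent, §2] -/
theorem shaCorank_seven_E₃' :
    haveI := KubertTateM115Descent.isElliptic
    (kubertTateSeven' (((-11 : ℤ) : ℚ)) (((5 : ℤ) : ℚ))).shaCorank 7 = 0 :=
  haveI := KubertTateM115Descent.isElliptic
  (shaCorank_seven_kubertTateSeven'_eq_zero_iff (-11) 5).2 KubertTateM115Descent.shaCorank_seven_eq_zero

/-- **`rank E'_{−11/5}(ℚ) = 2`, unconditionally.** [cite: SilvermanAEC2009, III.6.1 and Thm. X.4.2] -/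
theorem mordellWeilRank_E₃' :
    haveI := KubertTateM115Descent.isElliptic
    (kubertTateSeven' (((-11 : ℤ) : ℚ)) (((5 : ℤ) : ℚ))).mordellWeilRank = 2 :=
  haveI := KubertTateM115Descent.isElliptic
  (mordellWeilRank_kubertTateSeven'_eq (-11) 5).trans KubertTateM115Descent.mordellWeilRank_eq

/-- **`T` BY NAME at `p₀ = 7` on `E'_{−11/5}`.** [cite: SilvermanAEC2009, Thm. X.4.2(a)] -/
theorem transfer_at_seven_E₃' (hT : FiniteShaComponentTransfer) (q : ℕ) [Fact q.Prime] :
    haveI := KubertTateM115Descent.isElliptic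
    (kubertTateSeven' (((-11 : ℤ) : ℚ)) (((5 : ℤ) : ℚ))).shaCorank q = 0 :=
  haveI := KubertTateM115Descent.isElliptic
  transfer_at_seven_kubertTateSeven' hT (-11) 5 KubertTateM115Descent.shaCorank_seven_eq_zero q

/-- **The route's `O` holds for `E'_{−11/5}`, witness `p₀ = 7`, unconditionally** (rank `2`).
[cite: SilvermanAEC2009, Thm. X.4.2(a)] -/
theorem oneFiniteShaComponent_E₃' :
    haveI := KubertTateM115Descent.isElliptic
    ∃ (p : ℕ) (_ : Fact p.Prime), (kubertTateSeven' (((-11 : ℤ) : ℚ)) (((5 : ℤ) : ℚ))).shaCorank p = 0 :=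
  haveI := KubertTateM115Descent.isElliptic
  oneFiniteShaComponent_kubertTateSeven' (-11) 5 KubertTateM115Descent.shaCorank_seven_eq_zero

end Summit.BirchSwinnertonDyer.BirchSwinnertonDyer.Theorems.ShaPrimaryTransferDoorAtSevenDual

end
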